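import Literature.MathematicalPhysics.QuantumFieldTheory.Balaban1983to89.B5Action121
import Literature.MathematicalPhysics.QuantumFieldTheory.Balaban1983to89.B6Lemma24TorusWitness

/-!
# `Balaban1983to89.B5SectAStatements` — T. Bałaban, *Propagators and renormalization transformations for
# lattice gauge theories. I*, Commun. Math. Phys. **95** (1984) 17–40 [Balaban1984PropagatorsI]: Sect. A,
# the rescaled action (1.5), the positivity claim of p. 19, and the gauge invariance (1.15)

statement-level skeleton of published theorems with citation tags; proofs where landed; nothing here is a claim about the Yang–Mills mass gap

v1.1 (DOCFIX for ref-3's cite lint): framing sentence on one line; the private helper's docstring carries its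
locator; no declaration changed.

PDF held: `paper:balaban1984-cmp95-propagators-rt-i` (journal page = PDF page + 16).  Pages read for this module AS
IMAGES: renders `run/shared/lean/pub/pub-balaban/b2b-balaban-ref1/pages/1984-cmp95-propagators-rt-I/…-p002-x2.png`
(p. 18) and `…-p003-x2.png` (p. 19).

CITATION HEADER (lean-in-tree rule).  Cell `lit-balaban` (Phase 1), unit `lit-balaban-r02` (reader/typer of B5);
SKELETON rows `B5.Eq1.5`, `B5.Claim@19`, `B5.Eq1.15` of `run/shared/lean/pub/lit-balaban/lit-balaban-r02/ROWS-B5.md`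
(PHASE2-TARGETS.md §A lists `B5.Claim@19` among the absent numbered statements, §D lists `Eq1.5`, `Eq1.15`).

WHAT IS PRINTED (verbatim).
* p. 18 [PDF 2]: «To make the considerations more clear we rescale the action from the ε-lattice to the unit
  lattice by transformation A_μ(εx) = ε^{−(d−2)/2}A_μ(x), x∈T₁, and we get
  S(A) = ½ Σ_{p⊂T₁} |F(p)|² = ½ Σ_{p⊂T₁} |(∂A)(p)|².   (1.5)»
  (with (1.2) «F(p) = (∂A)(p) = ε^{−1}A(∂p) = ε^{−1}(A(x, y) + A(y, z) + A(z, w) + A(w, x))» and (1.3)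
  «S^ε(A) = ½ Σ_{p⊂T_ε} ε^d|F(p)|²», both typed by `B5Action121.Fs` / `B5Action121.actionS`).
* p. 19 [PDF 3]: «(QA)_c = Σ_{x∈B(c₋)} L^{−(d+1)}A([x, x(c)]), δ(B − QA) = Π_{c⊂T_L^{(1)}} δ(B_c − (QA)_c), (1.11)»
  and «The integral in (1.12) is obviously a Gaussian integral. We will prove later that the quadratic form
  ⟨∂A, ∂A⟩ is positive on the subspace of A satisfying QA = 0, A(Γ_{y,x}) = 0, x∈B(y), y∈T_L^{(1)}.»
  ("later" = part II [Balaban1984PropagatorsII], Lemma 2.4 (2.128) p. 245 and (2.153) p. 249, kernel-checked on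
  the torus by `B6Lemma24Torus.lemma24_torus_contour`).
* p. 19 [PDF 3]: «If we make a gauge transformation λ, then for the averaged field B we have
  B^λ_c = B_c − L^{−1}(λ(c₊) − λ(c₋)) = B_c − (∂λ)(c),   (1.9)» and «The form ⟨B, Δ₁B⟩ is gauge invariant. If λ₁
  is a gauge transformation on T_L^{(1)}, then defining λ on T₁ as constant on each block, λ(x) = λ₁(y) for
  x∈B(y), we have  Z^{(0)}exp(−½⟨B^{λ₁}, Δ₁B^{λ₁}⟩) = ∫dA δ(B^{λ₁} − QA^λ)δ_{Ax}(A^λ)exp(−S(A^λ))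
  = ∫dA δ(B − ∂λ₁ − QA + ∂Q′λ)δ_{Ax}(A)exp(−S(A)) = Z^{(0)}exp(−½⟨B, Δ₁B⟩).   (1.15)»

WHAT THIS MODULE DOES (three rows, each over an EXISTING carrier; nothing re-declared).
§1 (1.5) over the torus vector fields `Tor N × Fin d → ℂ` of `B5Action121` (the carrier of (1.2)–(1.4)):
   `action15` = S(A) (the unit-lattice action, `actionS N 1 1`), `rescale15 ε A` = the ε-lattice field
   `A^ε(εx) = ε^{−(d−2)/2}A(x)`, and (1.5) PROVED: `eq15 : S^ε(A^ε) = S(A)` (`actionS N ε⁻¹ ε^d (rescale15 ε A) =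
   action15 A`, every ε > 0, every d).
§2 the p. 19 claim over the torus configurations of `B6Lemma24Torus` (M-periodic real functions on the unit
   bonds of Z^d, L-blocks B(y), contours Γ_{y,x} of (1.7), Q of (1.11) = `B6Lemma24PrintedShape.q1`, the (1.8)
   average = `q18`): `ClaimP19 d L M` = for every configuration A on T₁ with A(Γ_{y,x}) = 0 (x ∈ B(y), y ∈ T_L^{(1)})
   and QA = 0, A ≠ 0 in ℓ²(T₁) ⟹ ⟨∂A, ∂A⟩ = Σ_{p⊂T₁}|(∂A)(p)|² > 0; PROVED for every d ≥ 2, L ≥ 1 and every torus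
   with L ∣ M_i (`claimP19_holds`), with the quantitative form ⟨∂A, ∂A⟩ ≥ (1/(12d²))L^{−d−1}‖A‖² that part II
   prints as (2.153) (`claimP19_quantitative`), the (1.8)-reading of "QA = 0" (`claimP19_holds18`) and
   non-vacuity of the constrained subspace for L ≥ 2 (`claimP19_nonvacuous`, from `B6Lemma24TorusWitness`).
§3 (1.15) for the tree's representation of ⟨B, Δ_kB⟩, the momentum formula (1.66) `B5Bounds167Lattice.formDk n M`
   (k ≥ 1, n = L^k; Δ₁: n = L): the lattice curl of (1.66) IS the plaquette field of (1.2) at unit lattice factor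
   (`curl_eq_Fs`), it is unchanged under B ↦ B^λ = B − ∂λ for ANY lattice factor of ∂ (`curl_gaugeT`), hence
   `eq115_formDk : ⟨B^λ, Δ_kB^λ⟩ = ⟨B, Δ_kB⟩` and `eq115_d1Sq : ⟨∂₁B^λ, ∂₁B^λ⟩ = ⟨∂₁B, ∂₁B⟩` — PROVED.
   HONEST SCOPE: the printed (1.15) is the chain of integral identities defining Δ₁ by (1.14); the tree defines
   ⟨B, Δ_kB⟩ by the explicit formula (1.66) (identity with (1.65)/(1.14) not certified, see `B5Bounds167Lattice`),
   and for that representation gauge invariance is the elementary `∂∘∂ = 0` proved here.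
-/

namespace Literature.MathematicalPhysics.QuantumFieldTheory.Balaban1983to89.B5SectAStatements

open scoped BigOperators Matrix
open Finset

noncomputable section

/-! ## §1  (1.5): the rescaled (unit-lattice) action and `S^ε(A^ε) = S(A)` -/

section Eq15

open B5Prop11Plancherel (Tor unitVec)
open B5Action121 (Fs Fs_apply actionS)

variable {d : ℕ} (N : Fin d → ℕ) [hN : ∀ μ, NeZero (N μ)]

/-- **(1.5)** p. 18 [PDF 2], verbatim: *"S(A) = ½ Σ_{p⊂T₁} |F(p)|² = ½ Σ_{p⊂T₁} |(∂A)(p)|²"* — typed reading: the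
action (1.3) `B5Action121.actionS` at unit lattice factor (ε = 1 in (1.2)) and unit plaquette weight (ε^d = 1),
on the torus T₁ with N_μ sites in direction μ (plaquettes p = ⟨x, x+e_μ, x+e_μ+e_ν, x+e_ν⟩, x ∈ T₁, μ < ν).
[cite: Balaban1984PropagatorsI, (1.5) p.18] -/
def action15 (A : Tor N × Fin d → ℂ) : ℝ := actionS N 1 1 A

/-- (1.5) unfolded: `S(A) = ½ Σ_{x∈T₁} Σ_{μ<ν} |F_{μν}(x)|²`. [cite: Balaban1984PropagatorsI, (1.5) p.18] -/
theorem action15_eq (A : Tor N × Fin d → ℂ) :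
    action15 N A = 1 / 2 * ∑ x, ∑ μ, ∑ ν, if μ < ν then ‖Fs N 1 A μ ν x‖ ^ 2 else 0 := by
  simp only [action15, actionS, one_mul]

/-- **The rescaling of p. 18**, verbatim: *"we rescale the action from the ε-lattice to the unit lattice by
transformation A_μ(εx) = ε^{−(d−2)/2}A_μ(x), x∈T₁"* — typed reading: the ε-lattice field A^ε attached to the
unit-lattice field A (the site εx of T_ε labelled by x ∈ T₁): `A^ε_μ(εx) = ε^{−(d−2)/2} A_μ(x)`.
[cite: Balaban1984PropagatorsI, (1.5) p.18] -/
def rescale15 (ε : ℝ) (A : Tor N × Fin d → ℂ) : Tor N × Fin d → ℂ :=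
  ((ε ^ (-(((d : ℝ) - 2) / 2)) : ℝ) : ℂ) • A

/-- The plaquette field (1.2) is linear: `F(sA) = sF(A)`. [cite: Balaban1984PropagatorsI, (1.2) p.18] -/
theorem Fs_smul (c s : ℂ) (A : Tor N × Fin d → ℂ) (μ ν : Fin d) (x : Tor N) :
    Fs N c (s • A) μ ν x = s * Fs N c A μ ν x := by
  simp only [Fs_apply, Pi.smul_apply, smul_eq_mul]
  ring

/-- The lattice factor of (1.2) scales out: `F^ε(p) = ε⁻¹A(∂p) = ε⁻¹·F¹(p)`. [cite: Balaban1984PropagatorsI, (1.2) p.18] -/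
theorem Fs_scale (c : ℂ) (A : Tor N × Fin d → ℂ) (μ ν : Fin d) (x : Tor N) :
    Fs N c A μ ν x = c * Fs N 1 A μ ν x := by
  rw [Fs_apply, Fs_apply, one_mul]

/-- the scalar bookkeeping of (1.5): `ε^d · (ε^{−(d−2)/2})² · (ε⁻¹)² = 1` (private arithmetic helper for `eq15`;
locator: Bałaban CMP 95 (1.5) p. 18; not a statement of the paper). [folklore] -/
private theorem scale_key {ε : ℝ} (hε : 0 < ε) (d : ℕ) :
    ε ^ d * (ε ^ (-(((d : ℝ) - 2) / 2))) ^ 2 * (ε⁻¹) ^ 2 = 1 := by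
  have hs : (ε ^ (-(((d : ℝ) - 2) / 2))) ^ 2 = ε ^ (2 - (d : ℝ)) := by
    rw [← Real.rpow_natCast, ← Real.rpow_mul hε.le]
    congr 1
    push_cast
    ring
  have hd : (ε ^ d : ℝ) = ε ^ (d : ℝ) := (Real.rpow_natCast ε d).symm
  have h2 : (ε⁻¹) ^ 2 = ε ^ (-2 : ℝ) := by
    rw [Real.rpow_neg hε.le, Real.rpow_two, inv_pow]
  rw [hs, hd, h2, ← Real.rpow_add hε, ← Real.rpow_add hε]
  have : (d : ℝ) + (2 - (d : ℝ)) + (-2 : ℝ) = 0 := by ring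
  rw [this, Real.rpow_zero]

/-- **(1.5) PROVED**: *"and we get S(A) = ½ Σ_{p⊂T₁}|F(p)|²"* — the ε-lattice action (1.3) (lattice factor ε⁻¹ in
(1.2), plaquette weight ε^d) of the rescaled field A^ε equals the unit-lattice action of A, for every ε > 0 and
every dimension d: `S^ε(A^ε) = S(A)`. [cite: Balaban1984PropagatorsI, (1.5) p.18] -/
theorem eq15 {ε : ℝ} (hε : 0 < ε) (A : Tor N × Fin d → ℂ) :
    actionS N ((ε : ℂ)⁻¹) (ε ^ d) (rescale15 N ε A) = action15 N A := by
  unfold action15 actionS rescale15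
  congr 1
  refine sum_congr rfl fun x _ => sum_congr rfl fun μ _ => sum_congr rfl fun ν _ => ?_
  split_ifs with h
  · have hs : 0 < ε ^ (-(((d : ℝ) - 2) / 2)) := Real.rpow_pos_of_pos hε _
    rw [Fs_smul, Fs_scale N ((ε : ℂ)⁻¹), norm_mul, norm_mul, norm_inv, Complex.norm_real, Complex.norm_real,
      Real.norm_eq_abs, Real.norm_eq_abs, abs_of_pos hs, abs_of_pos hε, one_mul]
    rw [show ε ^ d * (ε ^ (-(((d : ℝ) - 2) / 2)) * (ε⁻¹ * ‖Fs N 1 A μ ν x‖)) ^ 2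
        = (ε ^ d * (ε ^ (-(((d : ℝ) - 2) / 2))) ^ 2 * (ε⁻¹) ^ 2) * ‖Fs N 1 A μ ν x‖ ^ 2 by ring,
      scale_key hε, one_mul]
  · rfl

end Eq15

/-! ## §2  p. 19: positivity of `⟨∂A, ∂A⟩` on `{QA = 0, A(Γ_{y,x}) = 0}` — the torus T₁ tiled by L-blocks -/

section ClaimP19

open B6BondElimination (treeBonds)
open B6TreeGaugePoincare (Cfg)
open B6Lemma24PrintedShape (q1 q18 contourSum treeGauge_of_contour)
open B6Lemma24Torus (IsPeriodic coarseSites faces normSqT d1SqT q1SqT lemma24_torus_contour q18_eq_q1_torus)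
open B6Lemma24TorusWitness (exists_constrained_normSqT_pos)

variable {d : ℕ} {L : ℕ}

/-- **Claim p. 19** [PDF 3] (after (1.13)), verbatim: *"The integral in (1.12) is obviously a Gaussian integral. We
will prove later that the quadratic form ⟨∂A, ∂A⟩ is positive on the subspace of A satisfying QA = 0,
A(Γ_{y,x}) = 0, x∈B(y), y∈T_L^{(1)}."* — typed reading, on the torus T₁ = Z^d/(M₁Z × … × M_dZ) of the unit lattice
tiled by the blocks B(y) (1.6) of T_L^{(1)} = T₁ ∩ LZ^d (L ∣ M_i; a configuration on T₁ = an M-periodic real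
function on the unit bonds, `B6Lemma24Torus.IsPeriodic`): for every A on T₁ in the axial gauge A(Γ_{y,x}) = 0
(contours (1.7), `contourSum`) for x ∈ B(y), y ∈ T_L^{(1)}, with QA = 0 ((1.11): (QA)_c = 0 at every bond c of
T_L^{(1)}, `q1`), A ≠ 0 in ℓ²(T₁) (‖A‖²_{T₁} = Σ_{b⊂T₁}A_b² > 0) ⟹ ⟨∂A, ∂A⟩ = Σ_{p⊂T₁}|(∂A)(p)|² > 0
((∂A)(p) = A(∂p), (1.2) at ε = 1, `B6TreeGaugePoincare.curl`; sum over plaquette representatives `d1SqT`).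
Carrier clauses (F6): "positive on the subspace" is read as positive-definite on the constrained subspace.
[cite: Balaban1984PropagatorsI, p.19 (claim after (1.13))] -/
def ClaimP19 (d L : ℕ) (M : Fin d → ℕ) : Prop :=
  ∀ A : Cfg d, IsPeriodic M A →
    (∀ y ∈ coarseSites L M, ∀ x ∈ B6Elimination.block L y, contourSum L A y x = 0) →
    (∀ c ∈ faces L M, q1 L A c = 0) → 0 < normSqT M A → 0 < d1SqT M A

/-- **The quantitative form that part II proves** ((2.153) with γ₀ = 1, i.e. for the form ⟨∂A, ∂A⟩ itself): on the
torus T₁ (d ≥ 2, L ≥ 1, L ∣ M_i), for every A with A(Γ_{y,x}) = 0 (x ∈ B(y), y ∈ T_L^{(1)}) and QA = 0,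
`(1/(12d²)) L^{−d−1} ‖A‖²_{T₁} ≤ ⟨∂A, ∂A⟩` — `B6Lemma24Torus.lemma24_torus_contour` with its Q₁-term killed by QA = 0.
[cite: Balaban1984PropagatorsI, p.19 (claim after (1.13))] -/
theorem claimP19_quantitative (hd : 2 ≤ d) (hL : 1 ≤ L) {M : Fin d → ℕ} (hM : ∀ i, 0 < M i)
    (hLM : ∀ i, L ∣ M i) (A : Cfg d) (hA : IsPeriodic M A)
    (hAx : ∀ y ∈ coarseSites L M, ∀ x ∈ B6Elimination.block L y, contourSum L A y x = 0)
    (hQ : ∀ c ∈ faces L M, q1 L A c = 0) :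
    1 / (12 * (d : ℝ) ^ 2) * (L : ℝ) ^ (-((d : ℝ) + 1)) * normSqT M A ≤ d1SqT M A := by
  have h := lemma24_torus_contour hd hL hM hLM A hA hAx
  have hq : q1SqT L M A = 0 := sum_eq_zero fun c hc => by rw [hQ c hc]; ring
  rwa [hq, mul_zero, zero_add] at h

/-- **Claim p. 19 PROVED** on every torus T₁ of the stated kind (d ≥ 2, L ≥ 1, periods M_i ≥ 1 with L ∣ M_i):
⟨∂A, ∂A⟩ > 0 for every A ≠ 0 with QA = 0 and A(Γ_{y,x}) = 0, x ∈ B(y), y ∈ T_L^{(1)}.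
[cite: Balaban1984PropagatorsI, p.19 (claim after (1.13))] -/
theorem claimP19_holds (hd : 2 ≤ d) (hL : 1 ≤ L) {M : Fin d → ℕ} (hM : ∀ i, 0 < M i) (hLM : ∀ i, L ∣ M i) :
    ClaimP19 d L M := by
  unfold ClaimP19
  intro A hA hAx hQ hpos
  have h := claimP19_quantitative hd hL hM hLM A hA hAx hQ
  have hd0 : (0 : ℝ) < d := by exact_mod_cast (show 0 < d by omega)
  have hL0 : (0 : ℝ) < L := by exact_mod_cast hL
  have hc : 0 < 1 / (12 * (d : ℝ) ^ 2) * (L : ℝ) ^ (-((d : ℝ) + 1)) :=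
    mul_pos (by positivity) (Real.rpow_pos_of_pos hL0 _)
  exact lt_of_lt_of_le (mul_pos hc hpos) h

/-- The same claim with *"QA = 0"* read through the three-contour average B_c of (1.8) (`q18`) instead of (1.11) —
*"In the future we will use both points of view"* (p. 19); in the axial gauge the two averages coincide
(`B6Lemma24Torus.q18_eq_q1_torus`). [cite: Balaban1984PropagatorsI, p.19 (claim after (1.13)); (1.8) p.19] -/
theorem claimP19_holds18 (hd : 2 ≤ d) (hL : 1 ≤ L) {M : Fin d → ℕ} (hM : ∀ i, 0 < M i) (hLM : ∀ i, L ∣ M i)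
    (A : Cfg d) (hA : IsPeriodic M A)
    (hAx : ∀ y ∈ coarseSites L M, ∀ x ∈ B6Elimination.block L y, contourSum L A y x = 0)
    (hQ : ∀ c ∈ faces L M, q18 L A c = 0) (hpos : 0 < normSqT M A) : 0 < d1SqT M A := by
  have h := claimP19_holds hd hL hM hLM
  unfold ClaimP19 at h
  exact h A hA hAx
    (fun c hc => by
      rw [← q18_eq_q1_torus hM hLM hA (fun y hy => treeGauge_of_contour (hAx y hy)) hc]
      exact hQ c hc)
    hpos

/-- **Non-vacuity**: for d ≥ 2 and L ≥ 2 the constrained subspace of the claim is not {0} — there is an A ≠ 0 on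
T₁ with QA = 0 (in both readings) and A(Γ_{y,x}) = 0, and for it ⟨∂A, ∂A⟩ > 0 (the witness of
`B6Lemma24TorusWitness`). [cite: Balaban1984PropagatorsI, p.19 (claim after (1.13))] -/
theorem claimP19_nonvacuous (hd : 2 ≤ d) (hL : 2 ≤ L) {M : Fin d → ℕ} (hM : ∀ i, 0 < M i)
    (hLM : ∀ i, L ∣ M i) :
    ∃ A : Cfg d, IsPeriodic M A ∧
      (∀ y ∈ coarseSites L M, ∀ x ∈ B6Elimination.block L y, contourSum L A y x = 0) ∧
      (∀ c ∈ faces L M, q1 L A c = 0) ∧ (∀ c ∈ faces L M, q18 L A c = 0) ∧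
      0 < normSqT M A ∧ 0 < d1SqT M A := by
  obtain ⟨A, hA, -, hAx, hQ, hQ', hpos, hd1⟩ := exists_constrained_normSqT_pos hd hL hM hLM
  exact ⟨A, hA, hAx, hQ, hQ', hpos, hd1⟩

end ClaimP19

/-! ## §3  (1.15): gauge invariance of `⟨B, Δ_kB⟩` in the representation (1.66) -/

section Eq115

open B5Prop11Plancherel (Tor unitVec fdiff dft)
open B5Action121 (Fs Fs_apply sdiff_mulVec GradOp GradOp_mulVec gaugeT Fs_gaugeT)
open B5Bounds167Lattice (curl curlHat hat_curl formDk d1Sq)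

variable {d : ℕ} (n : ℕ) (M : Fin d → ℕ) [hM : ∀ μ, NeZero (M μ)]

/-- The lattice curl `(∂₁B)_{μν} = ∂¹_μB_ν − ∂¹_νB_μ` of (1.66) IS the plaquette field `F_{μν}` of (1.2) at unit
lattice factor. [cite: Balaban1984PropagatorsI, (1.2) p.18; (1.66) p.29] -/
theorem curl_eq_Fs (B : Tor M × Fin d → ℂ) (μ ν : Fin d) (x : Tor M) :
    curl M B μ ν x = Fs M 1 B μ ν x := by
  rw [Fs_apply, one_mul]
  simp only [curl, B5Action121.fdiff_mulVec_apply, sdiff_mulVec, B5Action121.comp, one_mul]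
  ring

/-- The gauge transformation (1.4)/(1.9) with lattice factor c, `B^λ = B − ∂λ`, `(∂λ)(b) = c(λ(b₊) − λ(b₋))`, is the
unit-factor transformation by `cλ`. [cite: Balaban1984PropagatorsI, (1.4) p.18; (1.9) p.19] -/
theorem gaugeT_eq_gaugeT_one (c : ℂ) (B : Tor M × Fin d → ℂ) (l : Tor M → ℂ) :
    gaugeT M c B l = gaugeT M 1 B (c • l) := by
  funext i
  obtain ⟨x, ν⟩ := i
  simp only [gaugeT, Pi.sub_apply, GradOp_mulVec, sdiff_mulVec, Pi.smul_apply, smul_eq_mul]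
  ring

/-- `∂₁(B^λ) = ∂₁B`: the plaquette field is unchanged under `B ↦ B − ∂λ` (any lattice factor), *"The covariant
derivative ∂A, and so the action above, are invariant"* (p. 18) — via `B5Action121.Fs_gaugeT`.
[cite: Balaban1984PropagatorsI, (1.4) p.18; (1.15) p.19] -/
theorem curl_gaugeT (c : ℂ) (B : Tor M × Fin d → ℂ) (l : Tor M → ℂ) (μ ν : Fin d) :
    curl M (gaugeT M c B l) μ ν = curl M B μ ν := by
  funext x
  rw [gaugeT_eq_gaugeT_one, curl_eq_Fs, curl_eq_Fs, Fs_gaugeT]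

/-- `(∂₁B^λ)~ = (∂₁B)~` in momentum space. [cite: Balaban1984PropagatorsI, (1.15) p.19; (1.66) p.29] -/
theorem curlHat_gaugeT (c : ℂ) (B : Tor M × Fin d → ℂ) (l : Tor M → ℂ) (μ ν : Fin d) (p : Tor M) :
    curlHat M (gaugeT M c B l) μ ν p = curlHat M B μ ν p := by
  rw [← hat_curl, ← hat_curl, curl_gaugeT]

/-- **(1.15) PROVED for the representation (1.66)**: *"The form ⟨B, Δ₁B⟩ is gauge invariant"* — for every k (n = L^k;
Δ₁: n = L), every torus, every lattice factor c of the gradient and every λ : T → ℂ,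
`⟨B − ∂λ, Δ_k(B − ∂λ)⟩ = ⟨B, Δ_kB⟩` with `⟨B, Δ_kB⟩` given by (1.66) (`B5Bounds167Lattice.formDk`).
[cite: Balaban1984PropagatorsI, (1.15) p.19] -/
theorem eq115_formDk (c : ℂ) (B : Tor M × Fin d → ℂ) (l : Tor M → ℂ) :
    formDk n M (gaugeT M c B l) = formDk n M B := by
  unfold formDk
  simp only [curlHat_gaugeT]

/-- (1.15), the `⟨∂₁B, ∂₁B⟩` member of (1.67): `⟨∂₁B^λ, ∂₁B^λ⟩ = ⟨∂₁B, ∂₁B⟩`. [cite: Balaban1984PropagatorsI, (1.15) p.19] -/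
theorem eq115_d1Sq (c : ℂ) (B : Tor M × Fin d → ℂ) (l : Tor M → ℂ) :
    d1Sq M (gaugeT M c B l) = d1Sq M B := by
  unfold d1Sq
  simp only [curl_gaugeT]

end Eq115

end

end Literature.MathematicalPhysics.QuantumFieldTheory.Balaban1983to89.B5SectAStatements
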